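import Summits.BirchSwinnertonDyer.BirchSwinnertonDyer.Theorems.ManinLocalTwoThreeQuarterShiftGamma1
import Summits.BirchSwinnertonDyer.BirchSwinnertonDyer.Theorems.ManinLocalTwoThreeShimuraQuotientLevelInstances
import Summits.BirchSwinnertonDyer.BirchSwinnertonDyer.Theorems.ManinLocalTwoThreeShimuraQuotientFourPQ
import Summits.BirchSwinnertonDyer.BirchSwinnertonDyer.Theorems.ManinLocalTwoThreeGammaOneIndexFour
import HarnessLib

/-!
# The Shimura quotient `Λ₀/Λ₁` is a `χ₋₄`-ORBIT INVARIANT: the `Γ₁` rotation `Λ₁(f_{D′}) = i·Λ₁(f_D)` for `χ₋₄`-pairs of data, equal index,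
# «Stevens' curve = optimal curve» and index `4` transported along every edge `N ∣ N′ ∣ 4N`, `16 ∣ N′`; NEW LEVELS `16q^e`, `16pq` (unconditional)
(route `ManinLocalTwoThree`, deciding crux C2 `ManinOddAtFour` stmt-BirchSwinnertonDyer-22967; cell bsd-f2-manin, C2/C3 LEAD p1 gen 18;
`--supports stmt-BirchSwinnertonDyer-22967`; sequel to `…ManinLocalTwoThreeQuarterShiftGamma1` (the `Γ₁` quarter-shift transfer `Λ₁(f) = s·Λ₁(g)`
for cusp forms), here specialised to the newforms of a `χ₋₄`-PAIR of modular-parametrisation data via es's `exists_quarterShiftSymbols_of_negOne_twist`)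

* §5 `periodLatticeGamma1_rotation_of_negOne_twist_of_dvd` — **`Λ₁(f_{D′}) = i·Λ₁(f_D)`** for data `D` of `W` at `N`, `D′` of `W′ ~ W ⊗ χ₋₄` at `N′`,
  `N ∣ N′ ∣ 4N`, `16 ∣ N′`, both additive at `2` (the `Γ₁` twin of es's `periodLattice_rotation_of_negOne_twist_of_dvd`); hence
  `relIndex_periodLatticeGamma1_eq_of_negOne_twist_of_dvd` (**`[Λ₀ : Λ₁]` equal at both ends**), `periodLatticeGamma1_eq_iff_of_negOne_twist_of_dvd`
  (**`Λ₁ = Λ₀` at `D′ ⟺` at `D`**), `periodLatticeGamma1_eq_two_mul_iff_of_negOne_twist_of_dvd` (**index `4` at `D′ ⟺` at `D`**: E-an-152b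
  `ShimuraIndexNeFourAtFour` holds or fails simultaneously on a `χ₋₄`-orbit).
* §6 TRANSPORTED LEVELS: `Λ₁ = Λ₀` (and `|c₀| = |c₁|`) for the twisted classes at `16q^e` from `4q^e`, `q ≡ 3 (mod 4)` (tree
  `periodLatticeGamma1_eq_of_four_mul_prime_pow`; at `16q^e` inertia alone is silent); index `≠ 4` for the twisted classes at the RANK-TWO level `16pq`
  from the rank-one level `4pq`, `p ≡ 3 (mod 4)` (tree `…ShimuraQuotientFourPQ` + `not_index_four_of_two_classes`) — E-an-152b was open at every
  rank-two level (lead g15 `…LevelInstances`: `240, 336, 528, 560, …`).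
CENSUS SHADOW (HOME/p1/g15/CENSUS-shimura-levels-p1-g15.md): the 49 index-`2` classes `N ≤ 75092` come in `χ₋₄`-twin pairs `4p ↔ 16p` (`20a1/80b1`,
`52a1/208c1`, `116c1/464e1`, …, and `24a1/48a1`, `40a1/80a1`), as the invariance predicts.  HONEST FRAMING: unconditional structure theorems; which index
occurs is NOT decided; C2, E-an-152b in general, Manin's conjecture and BSD are NOT proved.  No definitions, no named facts, no sorry.
[cite: Stevens1989, §2 and Lemma (5.4) p. 97] [cite: Shimura1971, Prop. 3.64] [cite: LingOesterle1991, §1, Thm. 1 and Thm. 6] [cite: Manin1972, Prop. 1.4 / Thm. 1.6]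
-/

set_option autoImplicit false
-- lint-debt: the directory name repeats the summit name (sibling precedent `ManinLocalTwoThreeShimuraQuotientHeckeAtFour.lean`)
set_option linter.dupNamespace false

noncomputable section

open scoped MatrixGroups ModularForm
open CongruenceSubgroup Complex
open WeierstrassCurve Literature.NumberTheory.EllipticCurves Literature.NumberTheory.EllipticCurves.ModularForms
open Summit.BirchSwinnertonDyer.Rank1Residual.ManinAdditive (QuarterShiftSymbols exists_quarterShiftSymbols_of_negOne_twist)

namespace Summit.BirchSwinnertonDyer.BirchSwinnertonDyer.Theorems.ManinLocalTwoThree.SigmaHabitat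

/-! ## §5 `χ₋₄`-pairs of modular-parametrisation data: the `Γ₁` rotation and the invariance of the Shimura quotient -/

section Pairs

variable {W W' : WeierstrassCurve ℚ} [W.IsElliptic] [W'.IsElliptic] {N N' : ℕ} [NeZero N] [NeZero N']

/-- **`Λ₁(f_{D′}) = i·Λ₁(f_D)`** for every `χ₋₄`-pair of data with `N ∣ N′ ∣ 4N`, `16 ∣ N′`, both curves additive at `2`
(`D`, `D′` ANY data of `W`, `W′ ~ W ⊗ χ₋₄`) — the `Γ₁` twin of es's `periodLattice_rotation_of_negOne_twist_of_dvd`.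
[cite: Stevens1989, Lemma (5.4) p. 97] -/
theorem periodLatticeGamma1_rotation_of_negOne_twist_of_dvd (D : ModularParametrizationData W N)
    (D' : ModularParametrizationData W' N') (hNN' : N ∣ N') (hN'4 : N' ∣ 4 * N) (h16 : 4 ^ 2 ∣ N')
    (h4W : 2 ^ 2 ∣ W.conductorNorm ℤ) (h4W' : 2 ^ 2 ∣ W'.conductorNorm ℤ)
    (hiso : IsIsogenous (W.quadraticTwist ((-1 : ℤ) : ℚ)) W') :
    ∀ z : ℂ, z ∈ periodLatticeGamma1 D'.f ↔ Complex.I * z ∈ periodLatticeGamma1 D.f := by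
  obtain ⟨s, hs2, hq⟩ := exists_quarterShiftSymbols_of_negOne_twist D D' hNN' h16 h4W h4W' hiso
  have hs : s ^ 2 = Complex.I ^ 2 := by rw [hs2, Complex.I_sq]
  have hs0 : s ≠ 0 := by rintro rfl; norm_num at hs2
  have key := periodLatticeGamma1_iff_of_quarterShift hNN' hN'4 h16 hs0 hq
  intro z
  rcases sq_eq_sq_iff_eq_or_eq_neg.mp hs with hI | hI
  · rw [← hI]; exact key z
  · rw [key z, hI, neg_mul, neg_mem_iff]

/-- **The order of the Shimura quotient is a `χ₋₄`-ORBIT INVARIANT**: `[Λ₀(f_D) : Λ₁(f_D)] = [Λ₀(f_{D′}) : Λ₁(f_{D′})]` for every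
`χ₋₄`-pair as above. [cite: Stevens1989, §2] -/
theorem relIndex_periodLatticeGamma1_eq_of_negOne_twist_of_dvd (D : ModularParametrizationData W N)
    (D' : ModularParametrizationData W' N') (hNN' : N ∣ N') (hN'4 : N' ∣ 4 * N) (h16 : 4 ^ 2 ∣ N')
    (h4W : 2 ^ 2 ∣ W.conductorNorm ℤ) (h4W' : 2 ^ 2 ∣ W'.conductorNorm ℤ)
    (hiso : IsIsogenous (W.quadraticTwist ((-1 : ℤ) : ℚ)) W') :
    (periodLatticeGamma1 D.f).relIndex (periodLattice D.f) =
      (periodLatticeGamma1 D'.f).relIndex (periodLattice D'.f) := by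
  obtain ⟨s, hs2, hq⟩ := exists_quarterShiftSymbols_of_negOne_twist D D' hNN' h16 h4W h4W' hiso
  have hs0 : s ≠ 0 := by rintro rfl; norm_num at hs2
  exact relIndex_periodLatticeGamma1_eq_of_quarterShift hNN' hN'4 h16 hs0 hq

/-- **«Stevens' curve = the optimal curve» (`Λ₁ = Λ₀`) is a `χ₋₄`-orbit property.** -/
theorem periodLatticeGamma1_eq_iff_of_negOne_twist_of_dvd (D : ModularParametrizationData W N)
    (D' : ModularParametrizationData W' N') (hNN' : N ∣ N') (hN'4 : N' ∣ 4 * N) (h16 : 4 ^ 2 ∣ N')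
    (h4W : 2 ^ 2 ∣ W.conductorNorm ℤ) (h4W' : 2 ^ 2 ∣ W'.conductorNorm ℤ)
    (hiso : IsIsogenous (W.quadraticTwist ((-1 : ℤ) : ℚ)) W') :
    periodLatticeGamma1 D'.f = periodLattice D'.f ↔ periodLatticeGamma1 D.f = periodLattice D.f := by
  obtain ⟨s, hs2, hq⟩ := exists_quarterShiftSymbols_of_negOne_twist D D' hNN' h16 h4W h4W' hiso
  have hs0 : s ≠ 0 := by rintro rfl; norm_num at hs2
  exact periodLatticeGamma1_eq_iff_of_quarterShift hNN' hN'4 h16 hs0 hq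

/-- **Index `4` (`Λ₁ = 2Λ₀`) is a `χ₋₄`-orbit property** — E-an-152b `ShimuraIndexNeFourAtFour` holds or fails SIMULTANEOUSLY at both ends
of every `χ₋₄` edge `N ∣ N′ ∣ 4N`, `16 ∣ N′`. -/
theorem periodLatticeGamma1_eq_two_mul_iff_of_negOne_twist_of_dvd (D : ModularParametrizationData W N)
    (D' : ModularParametrizationData W' N') (hNN' : N ∣ N') (hN'4 : N' ∣ 4 * N) (h16 : 4 ^ 2 ∣ N')
    (h4W : 2 ^ 2 ∣ W.conductorNorm ℤ) (h4W' : 2 ^ 2 ∣ W'.conductorNorm ℤ)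
    (hiso : IsIsogenous (W.quadraticTwist ((-1 : ℤ) : ℚ)) W') :
    (∀ z : ℂ, z ∈ periodLatticeGamma1 D'.f ↔ ∃ w ∈ periodLattice D'.f, z = 2 * w) ↔
      (∀ z : ℂ, z ∈ periodLatticeGamma1 D.f ↔ ∃ w ∈ periodLattice D.f, z = 2 * w) := by
  obtain ⟨s, hs2, hq⟩ := exists_quarterShiftSymbols_of_negOne_twist D D' hNN' h16 h4W h4W' hiso
  have hs0 : s ≠ 0 := by rintro rfl; norm_num at hs2
  exact periodLatticeGamma1_eq_two_mul_iff_of_quarterShift hNN' hN'4 h16 hs0 hq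

end Pairs

/-! ## §6 New levels by transport along the `χ₋₄` edge `4q^e → 16q^e` and `4pq → 16pq` -/

section Transport

variable {W W' W₁' : WeierstrassCurve ℚ} [W.IsElliptic] [W'.IsElliptic] {N N' : ℕ} [NeZero N] [NeZero N']

/-- **STEVENS' CURVE IS THE OPTIMAL CURVE for the `χ₋₄`-twists at `N′ = 16q^e` of the classes at `N = 4q^e`, `q ≡ 3 (mod 4)` prime**:
`Λ₁(f_{D′}) = Λ₀(f_{D′})` for ANY datum `D′` of `W′ ~ W ⊗ χ₋₄` at level `16q^e` (both curves additive at `2`), transported from the tree's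
`periodLatticeGamma1_eq_of_four_mul_prime_pow` at `4q^e` — at `16q^e` itself cuspidal inertia decides nothing (`(ℤ/4q^{⌈e/2⌉})ˣ/{±1}` has even
order).  E.g. `28a ⊗ χ₋₄` at `112`, `44a ⊗ χ₋₄` at `176`, `76a ⊗ χ₋₄` at `304`. [cite: Stevens1989, §2] [cite: LingOesterle1991, Thm. 1 and Thm. 6] -/
theorem periodLatticeGamma1_eq_of_negOne_twist_of_four_mul_prime_pow {q e : ℕ} (hq : q.Prime) (hq3 : q % 4 = 3)
    (he : e ≠ 0) (hN : N = 4 * q ^ e) (hN' : N' = 16 * q ^ e) (D : ModularParametrizationData W N)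
    (D' : ModularParametrizationData W' N') (h4W : 2 ^ 2 ∣ W.conductorNorm ℤ) (h4W' : 2 ^ 2 ∣ W'.conductorNorm ℤ)
    (hiso : IsIsogenous (W.quadraticTwist ((-1 : ℤ) : ℚ)) W') :
    periodLatticeGamma1 D'.f = periodLattice D'.f :=
  (periodLatticeGamma1_eq_iff_of_negOne_twist_of_dvd D D' ⟨4, by rw [hN, hN']; ring⟩ ⟨1, by rw [hN, hN']; ring⟩
    ⟨q ^ e, by rw [hN']; ring⟩ h4W h4W' hiso).mpr (periodLatticeGamma1_eq_of_four_mul_prime_pow hq hq3 he hN D)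

/-- … hence **`|c₀| = |c₁|` (the Γ₀/Γ₁ Manin-constant transfer, E-an-151) on those classes at `16q^e`**: for a lattice-optimal `X₀(16q^e)`-datum
`D′` of the twisted class and Stevens' optimal `X₁(16q^e)`-datum `D₁′` of an isogenous globally minimal curve. [cite: Stevens1989, §2] -/
theorem natAbs_maninConstant₀_eq_of_negOne_twist_of_four_mul_prime_pow [W'.IsGloballyMinimal] [W₁'.IsElliptic]
    [W₁'.IsGloballyMinimal] {q e : ℕ} (hq : q.Prime) (hq3 : q % 4 = 3) (he : e ≠ 0) (hN : N = 4 * q ^ e) (hN' : N' = 16 * q ^ e)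
    (D : ModularParametrizationData W N) (D' : ModularParametrizationData W' N') (D₁' : Gamma1ParametrizationData W₁' N')
    (h4W : 2 ^ 2 ∣ W.conductorNorm ℤ) (h4W' : 2 ^ 2 ∣ W'.conductorNorm ℤ) (hiso : IsIsogenous (W.quadraticTwist ((-1 : ℤ) : ℚ)) W')
    (hiso₁ : IsIsogenous W₁' W') (h₁ : D₁'.IsOptimal) (h₀ : ∀ z ∈ D'.L.lattice, ∃ w ∈ periodLattice D'.f, z = D'.c * w) :
    D'.maninConstant.natAbs = D₁'.maninConstant.natAbs :=
  natAbs_maninConstant₀_eq_of_periodLatticeGamma1_eq_periodLattice D₁' D' h₁ h₀ (D₁'.f_eq_of_isIsogenous D' hiso₁)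
    (periodLatticeGamma1_eq_of_negOne_twist_of_four_mul_prime_pow hq hq3 he hN hN' D D' h4W h4W' hiso)

/-- **INDEX `4` EXCLUDED for the `χ₋₄`-twists at `N′ = 16pq` of the lattice-optimal classes at `N = 4pq`, `p ≡ 3 (mod 4)`** (`p ≠ q` odd primes):
at `4pq` the Shimura quotient has `≤ 2` classes (tree `exists_forall_mem_or_sub_mem_four_mul_mul`, a RANK-ONE level), so a lattice-optimal datum there
has `Λ₁ ≠ 2Λ₀` (`not_index_four_of_two_classes`), and index `4` is a `χ₋₄`-orbit property (§5) — whereas `16pq` is a RANK-TWO level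
(`((ℤ/4pq)ˣ/{±1}) ⊗ 𝔽₂` has rank `2`), where E-an-152b was OPEN for every class (lead g15 LevelInstances list: `240, 336, 528, 560, …`).
[cite: LingOesterle1991, §1, Thm. 1 and Thm. 6] [cite: Stevens1989, §2] -/
theorem not_periodLatticeGamma1_eq_two_mul_of_negOne_twist_of_four_mul_mul {p q : ℕ} (hp : p.Prime) (hq : q.Prime)
    (hp2 : p ≠ 2) (hq2 : q ≠ 2) (hpq : p ≠ q) (hp3 : p % 4 = 3) (hN : N = 4 * p * q) (hN' : N' = 16 * p * q)
    (D : ModularParametrizationData W N) (D' : ModularParametrizationData W' N')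
    (h₀ : ∀ z ∈ D.L.lattice, ∃ w ∈ periodLattice D.f, z = D.c * w)
    (h4W : 2 ^ 2 ∣ W.conductorNorm ℤ) (h4W' : 2 ^ 2 ∣ W'.conductorNorm ℤ) (hiso : IsIsogenous (W.quadraticTwist ((-1 : ℤ) : ℚ)) W') :
    ¬ (∀ z : ℂ, z ∈ periodLatticeGamma1 D'.f ↔ ∃ w ∈ periodLattice D'.f, z = 2 * w) := by
  obtain ⟨γ₀, hγ₀⟩ := exists_forall_mem_or_sub_mem_four_mul_mul D.f hp hq hp2 hq2 hpq hp3 hN D.isNewformOf.1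
  have hD := not_index_four_of_two_classes D h₀ hγ₀
  rw [periodLatticeGamma1_eq_two_mul_iff_of_negOne_twist_of_dvd D D' ⟨4, by rw [hN, hN']; ring⟩
    ⟨1, by rw [hN, hN']; ring⟩ ⟨p * q, by rw [hN']; ring⟩ h4W h4W' hiso]
  exact hD

end Transport

end Summit.BirchSwinnertonDyer.BirchSwinnertonDyer.Theorems.ManinLocalTwoThree.SigmaHabitat

end
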